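import Summits.RiemannHypothesis.RiemannHypothesis.Theorems.GapsEvoDoorsSincDefs

/-!
# GapsEvoDoors — the sinc⁴ witness for `DeltaCIFinite`: admissibility clauses

Cell rh-gaps (D-0143/D-0145), engine EVO-TF-1 (eng-1 g2): the door-(a) SEARCH OBJECT of route
`GapsEvoDoors` (item stmt-RiemannHypothesis-22421 `DeltaCIFinite`) settled in the kernel by ONE
elementary test function of the engine's band-limited genus (BL: `r = (λ² − u²)·h²`, `ĥ` =
triangle), found by exact evaluation of the cell functional (work/numerics/bl_triangle_cert.py;
cf. the certified witnesses of record (3/2, 1/20, 0.48381) eng-2 PW-SOS / (7/5, 1/20, 0.4999)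
eng-1 HG, referee V-11/V-12/V-13, and the Fejér triangle (8, 1/20, 0.499), V-16 — none of which is
needed here). Window Δ = 2 (the fragment «F → 1 on 1 < |α| ≤ 2»), ε = 1/100, λ = 49/100; this
one-function family has λ*(Δ = 2) = √(15/(7π²)) = 0.46597 (float; engines' class optimum at Δ = 2
is 0.375). A pure real-analysis ∃-statement: no RH, no zeta; computed ≠ proved applies to every
engine number quoted, NOT to the theorems below; nothing here bears on the truth of RH.

Proved here (pure real analysis): `r` is even, continuous, `r(0) = 1`, `r ≤ 1`, `r ≤ 0` off
`[−λ, λ]`, `|r(u)| ≤ 2(1 + λ⁻²)/(1 + u²)` hence `r ∈ L¹`; the closed form `witnessHat` is even,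
continuous, compactly supported in `[−2, 2]` (so `L¹` and `= 0` for `|α| ≥ 2`), equals the
polynomial pieces `pieceA` / `pieceB` on `[0,1]` / `[1,2]`, is `≥ 0` for `|α| ≥ 1`, and
`witnessHat 0 = 2/3 − 2μ`.
-/

noncomputable section

open Real MeasureTheory Set Filter Topology
open scoped FourierTransform
open Literature.NumberTheory.LFunctions Literature.NumberTheory.LFunctions.BGMM2023

set_option linter.dupNamespace false  -- the mandated namespace repeats `RiemannHypothesis`

namespace Summit.RiemannHypothesis.RiemannHypothesis.Theorems.GapsEvoDoorsSinc

/-! ## Constants -/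

/-- `0 < λ < 1/2` (`λ = 49/100`). -/
theorem lam_bounds : 0 < lam ∧ lam < 1 / 2 := by unfold lam; constructor <;> norm_num

/-- `0 < μ`. -/
theorem mu_pos : 0 < mu := by
  unfold mu
  have := lam_bounds.1
  positivity

/-- `μ · (2πu)² = u²/λ²`. -/
theorem mu_mul_sq (u : ℝ) : mu * (2 * π * u) ^ 2 = u ^ 2 / lam ^ 2 := by
  unfold mu
  have h1 : (0 : ℝ) < π := Real.pi_pos
  have h2 : 0 < lam := lam_bounds.1
  field_simp
  ring

/-! ## The witness `r` -/

/-- `r` is even. -/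
theorem witness_neg (u : ℝ) : witness (-u) = witness u := by
  unfold witness
  rw [show π * -u = -(π * u) by ring, Real.sinc_neg]
  ring

/-- `r` is continuous. -/
theorem witness_continuous : Continuous witness := by
  unfold witness
  fun_prop

/-- `r(0) = 1`. -/
theorem witness_zero : witness 0 = 1 := by
  simp [witness]

/-- `0 ≤ sinc(x)⁴ ≤ 1`. -/
theorem sinc_pow_four_le_one (x : ℝ) : Real.sinc x ^ 4 ≤ 1 := by
  have h := Real.abs_sinc_le_one x
  have h2 : Real.sinc x ^ 4 = |Real.sinc x| ^ 4 := by
    rw [show (4 : ℕ) = 2 * 2 from rfl, pow_mul, pow_mul, sq_abs]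
  rw [h2]
  exact pow_le_one₀ (abs_nonneg _) h

/-- `sinc(x)⁴ ≤ 1/x⁴` for `x ≠ 0`. -/
theorem sinc_pow_four_le_inv {x : ℝ} (hx : x ≠ 0) : Real.sinc x ^ 4 ≤ 1 / x ^ 4 := by
  rw [Real.sinc_of_ne_zero hx, div_pow]
  have hx4 : 0 < x ^ 4 := by positivity
  refine div_le_div_of_nonneg_right ?_ hx4.le
  have h := Real.abs_sin_le_one x
  have h2 : Real.sin x ^ 4 = |Real.sin x| ^ 4 := by
    rw [show (4 : ℕ) = 2 * 2 from rfl, pow_mul, pow_mul, sq_abs]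
  rw [h2]
  exact pow_le_one₀ (abs_nonneg _) h

/-- `r ≤ 1`. -/
theorem witness_le_one (u : ℝ) : witness u ≤ 1 := by
  unfold witness
  have hs0 : 0 ≤ Real.sinc (π * u) ^ 4 := by positivity
  have hs1 : Real.sinc (π * u) ^ 4 ≤ 1 := sinc_pow_four_le_one _
  have hl : 0 < lam ^ 2 := by have := lam_bounds.1; positivity
  have hf : 1 - u ^ 2 / lam ^ 2 ≤ 1 := by
    have : 0 ≤ u ^ 2 / lam ^ 2 := by positivity
    linarith
  calc (1 - u ^ 2 / lam ^ 2) * Real.sinc (π * u) ^ 4 ≤ 1 * Real.sinc (π * u) ^ 4 :=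
        mul_le_mul_of_nonneg_right hf hs0
    _ ≤ 1 := by rw [one_mul]; exact hs1

/-- `r(u) ≤ 0` for `|u| > λ`. -/
theorem witness_nonpos {u : ℝ} (hu : lam < |u|) : witness u ≤ 0 := by
  unfold witness
  have hs0 : 0 ≤ Real.sinc (π * u) ^ 4 := by positivity
  have hl : 0 < lam := lam_bounds.1
  have hl2 : lam ^ 2 < u ^ 2 := by
    have : lam ^ 2 < |u| ^ 2 := by gcongr
    rwa [sq_abs] at this
  have hf : 1 - u ^ 2 / lam ^ 2 ≤ 0 := by
    rw [sub_nonpos, le_div_iff₀ (by positivity)]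
    linarith
  exact mul_nonpos_of_nonpos_of_nonneg hf hs0

/-- The decay bound `|r(u)| ≤ 2(1 + λ⁻²)/(1 + u²)`. -/
theorem abs_witness_le (u : ℝ) : |witness u| ≤ 2 * (1 + 1 / lam ^ 2) * (1 + u ^ 2)⁻¹ := by
  have hl : 0 < lam := lam_bounds.1
  have hl2 : 0 < lam ^ 2 := by positivity
  have hs0 : 0 ≤ Real.sinc (π * u) ^ 4 := by positivity
  have hfac : |1 - u ^ 2 / lam ^ 2| ≤ 1 + u ^ 2 / lam ^ 2 := by
    have h0 : 0 ≤ u ^ 2 / lam ^ 2 := by positivity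
    rw [abs_le]; constructor <;> linarith
  have habs : |witness u| = |1 - u ^ 2 / lam ^ 2| * Real.sinc (π * u) ^ 4 := by
    unfold witness
    rw [abs_mul, abs_of_nonneg hs0]
  rw [habs]
  have hu2 : 0 < 1 + u ^ 2 := by positivity
  rcases le_or_gt |u| 1 with h | h
  · -- `|u| ≤ 1`: `sinc⁴ ≤ 1`, `1 + u²/λ² ≤ 1 + 1/λ²`, `(1+u²)⁻¹ ≥ 1/2`
    have hu1 : u ^ 2 ≤ 1 := by
      have : |u| ^ 2 ≤ 1 ^ 2 := by gcongr
      rwa [sq_abs, one_pow] at this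
    have h1 : |1 - u ^ 2 / lam ^ 2| * Real.sinc (π * u) ^ 4 ≤ (1 + 1 / lam ^ 2) * 1 := by
      refine mul_le_mul (hfac.trans ?_) (sinc_pow_four_le_one _) hs0 (by positivity)
      have : u ^ 2 / lam ^ 2 ≤ 1 / lam ^ 2 := div_le_div_of_nonneg_right hu1 hl2.le
      linarith
    have h2 : (1 + 1 / lam ^ 2) * 1 ≤ 2 * (1 + 1 / lam ^ 2) * (1 + u ^ 2)⁻¹ := by
      rw [mul_one, mul_assoc]
      have h3 : 1 ≤ 2 * (1 + u ^ 2)⁻¹ := by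
        rw [le_mul_inv_iff₀ hu2]; linarith
      have h4 : 0 ≤ 1 + 1 / lam ^ 2 := by positivity
      nlinarith
    exact h1.trans h2
  · -- `|u| > 1`: `sinc⁴(πu) ≤ 1/(πu)⁴ ≤ 1/u⁴`
    have hu0 : u ≠ 0 := by
      intro h0; rw [h0, abs_zero] at h; linarith
    have hpu : π * u ≠ 0 := mul_ne_zero Real.pi_pos.ne' hu0
    have hu1 : 1 < u ^ 2 := by
      have : 1 ^ 2 < |u| ^ 2 := by gcongr
      rwa [sq_abs, one_pow] at this
    have hs : Real.sinc (π * u) ^ 4 ≤ 1 / u ^ 4 := by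
      refine (sinc_pow_four_le_inv hpu).trans ?_
      rw [mul_pow]
      have hπ4 : 1 ≤ π ^ 4 := by
        have := Real.pi_gt_three
        have : (1 : ℝ) ≤ π := by linarith
        exact one_le_pow₀ this
      have hu4 : 0 < u ^ 4 := by positivity
      rw [div_le_div_iff₀ (by positivity) hu4]
      nlinarith
    have hu4 : 0 < u ^ 4 := by positivity
    calc |1 - u ^ 2 / lam ^ 2| * Real.sinc (π * u) ^ 4
        ≤ (1 + u ^ 2 / lam ^ 2) * (1 / u ^ 4) := mul_le_mul hfac hs hs0 (by positivity)
      _ = (1 / u ^ 2 + 1 / lam ^ 2) * (1 / u ^ 2) := by field_simp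
      _ ≤ (1 + 1 / lam ^ 2) * (2 * (1 + u ^ 2)⁻¹) := by
          refine mul_le_mul ?_ ?_ (by positivity) (by positivity)
          · have : 1 / u ^ 2 ≤ 1 := by rw [div_le_one (by positivity)]; exact hu1.le
            linarith
          · have h5 : 1 / u ^ 2 ≤ 2 / (1 + u ^ 2) := by
              rw [div_le_div_iff₀ (by positivity) hu2]; nlinarith
            simpa [div_eq_mul_inv] using h5
      _ = 2 * (1 + 1 / lam ^ 2) * (1 + u ^ 2)⁻¹ := by ring


/-- `r ∈ L¹(ℝ)`. -/
theorem witness_integrable : Integrable witness := by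
  have hdom : Integrable fun u : ℝ ↦ 2 * (1 + 1 / lam ^ 2) * (1 + u ^ 2)⁻¹ :=
    integrable_inv_one_add_sq.const_mul _
  refine hdom.mono' witness_continuous.aestronglyMeasurable (Eventually.of_forall fun u ↦ ?_)
  rw [Real.norm_eq_abs]
  exact abs_witness_le u

/-! ## The closed form `r̂` -/

/-- `r̂` is even. -/
theorem witnessHat_neg (a : ℝ) : witnessHat (-a) = witnessHat a := by
  unfold witnessHat; rw [abs_neg]

/-- `r̂` is continuous. -/
theorem witnessHat_continuous : Continuous witnessHat := by
  unfold witnessHat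
  fun_prop

/-- `r̂(α) = 0` for `|α| ≥ 2`. -/
theorem witnessHat_eq_zero {a : ℝ} (ha : 2 ≤ |a|) : witnessHat a = 0 := by
  unfold witnessHat
  rw [max_eq_right (by linarith), max_eq_right (by linarith)]
  ring

/-- `r̂ = pieceA` on `[0, 1]`. -/
theorem witnessHat_eq_pieceA {x : ℝ} (h0 : 0 ≤ x) (h1 : x ≤ 1) : witnessHat x = pieceA x := by
  unfold witnessHat pieceA
  rw [abs_of_nonneg h0, max_eq_left (by linarith), max_eq_left (by linarith)]
  ring

/-- `r̂ = pieceB` on `[1, 2]`. -/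
theorem witnessHat_eq_pieceB {x : ℝ} (h1 : 1 ≤ x) (h2 : x ≤ 2) : witnessHat x = pieceB x := by
  unfold witnessHat pieceB
  rw [abs_of_nonneg (by linarith), max_eq_left (by linarith), max_eq_right (by linarith)]
  ring

/-- `r̂(0) = 2/3 − 2μ`. -/
theorem witnessHat_zero : witnessHat 0 = 2 / 3 - 2 * mu := by
  unfold witnessHat
  rw [abs_zero, sub_zero, sub_zero, max_eq_left (by norm_num), max_eq_left (by norm_num)]
  ring

/-- `pieceB ≥ 0` on `[1, 2]`. -/
theorem pieceB_nonneg {x : ℝ} (h2 : x ≤ 2) : 0 ≤ pieceB x := by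
  unfold pieceB
  have hm := mu_pos
  have : 0 ≤ 2 - x := by linarith
  positivity

/-- `r̂(α) ≥ 0` for `|α| ≥ 1`. -/
theorem witnessHat_nonneg {a : ℝ} (ha : 1 ≤ |a|) : 0 ≤ witnessHat a := by
  rcases le_or_gt 2 |a| with h | h
  · rw [witnessHat_eq_zero h]
  · rw [← witnessHat_neg, ← witnessHat_neg, neg_neg]
    rcases le_or_gt 0 a with h0 | h0
    · rw [abs_of_nonneg h0] at ha h
      rw [witnessHat_eq_pieceB ha h.le]
      exact pieceB_nonneg h.le
    · rw [abs_of_neg h0] at ha h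
      rw [← witnessHat_neg, witnessHat_eq_pieceB ha h.le]
      exact pieceB_nonneg h.le

/-- `r̂` has compact support. -/
theorem witnessHat_hasCompactSupport : HasCompactSupport witnessHat := by
  refine HasCompactSupport.intro (K := Set.Icc (-2) 2) isCompact_Icc fun x hx ↦ ?_
  apply witnessHat_eq_zero
  rw [Set.mem_Icc, not_and_or, not_le, not_le] at hx
  rcases hx with h | h
  · rw [abs_of_neg (by linarith)]; linarith
  · rw [abs_of_pos (by linarith)]; linarith

/-- `r̂ ∈ L¹(ℝ)`. -/
theorem witnessHat_integrable : Integrable witnessHat :=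
  witnessHat_continuous.integrable_of_hasCompactSupport witnessHat_hasCompactSupport

end Summit.RiemannHypothesis.RiemannHypothesis.Theorems.GapsEvoDoorsSinc

end
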